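import Mathlib
import Summits.NavierStokesRegularity.NavierStokesRegularity.Theorems.ThreadingFluxHorizonTowerSecondDigit
import Summits.NavierStokesRegularity.NavierStokesRegularity.Theorems.ThreadingFluxHorizonTowerFiniteTowerEvenPairSplit
import Summits.NavierStokesRegularity.NavierStokesRegularity.Theorems.ThreadingFluxHorizonTowerQuadraticGeneratorOcticBrackets
import Summits.NavierStokesRegularity.NavierStokesRegularity.Theorems.ThreadingFluxHorizonTowerTwoFourSixDigits
import Summits.NavierStokesRegularity.NavierStokesRegularity.Theorems.ThreadingFluxHorizonTowerFiniteTowerZonality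
import HarnessLib

/-!
# Crux `PoloidalLiouville` (stmt-NavierStokesRegularity-1222), crux idea «horizon-threading-tower» (ns-idea-15):
# FINITE TOWERS AT ORDER ONE — THM H: THE SECOND CONE DIGIT (top pair with `gcd = 2`, no shell of degree `D′ − 2`)

Support file (`--supports stmt-NavierStokesRegularity-1222`, helper; cell `ns-wall-extremal`, width hand ns-wall-eng-3 g5; 0 kit).

★★ THM H `finiteTower_zonal_of_evenPair`: a scale-free FINITE tower `Σ_{l∈K} U_{H_l}` of horizon profiles of smooth homogeneous
harmonic shells (degrees `≥ 1`) annihilated by the order-one horizon law off the centre, whose two largest degrees are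
`D′ = 2(m+2) < D = 2(n+2)` with `m + 2`, `n + 2` COPRIME (so `gcd(D′, D) = 2`), with `H_D, H_{D′} ≢ 0` and NO shell of degree `D′ − 2`, is
COAXIALLY ZONAL.  This is the whole family behind THM F (`{2, 6, 8}`): `{2, 8, 10}`, `{4, 8, 10}`, `{2, 4, 8, 10}`, `{2, 6, 10}`,
`{4, 10, 14}`, … — no explicit harmonic projection is needed.
PROOF: null-cone digit of the top bracket (g4's Wronskian) ⇒ `chartT P_{D′} = γ q^{m+2}`, `chartT P_D = lc·q^{n+2}`, `deg q ≤ 4` ⇒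
`q` is the chart of a complex quadratic generator `L_ℂ` ⇒ REALITY `L_ℂ = w•L` (`…SecondDigit`) ⇒ by NULL-CONE DIVISIBILITY
`P_{D′} = g₁L^{m+2} + ρG₁`, `P_D = g₂L^{n+2} + ρG₂` over `ℝ` ⇒ SECOND DIGIT `(8m+14)(8n+14){P_{D′},P_D} = ρ(96(m+2)(n+2)(m−n)g₁g₂ L^{m+n+1}W + ρS)`
while the class identity gives `2c₀{P_{D′},P_D} + ρ²R = 0` (no competitor on level `N − 2`) ⇒ `chartT W · (chartT L)^{m+n+1} = 0` ⇒ the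
harmonic cubic `W = det(x,Qx,Q²x)` vanishes ⇒ `{L, M₀} = 0` ⇒ same-degree rigidity (p684047) ⇒ `Q² = βQ + γI` ⇒ uniaxial lemma ⇒ `L`
zonal about a real axis `n` ⇒ `chartT L = β'(chartT⟪n,x⟫)²` ⇒ `chartT P_D = g₂β'^{n+2}(chartT⟪n,x⟫)^D` ⇒ `P_D` zonal about `n`
(`detP_lin_eq_zero_of_chartT_eq`) ⇒ THM A descends.

HONEST LABEL: an infinite family of cells of the crux-idea CONJECTURE `HorizonTowerZonality` at ORDER ONE; towers whose top pair has
`gcd ≥ 3`, or `gcd = 2` WITH a shell of degree `D′ − 2` (beyond `{2,4,6}`, `{4,6,8}`), and the general tower stay OPEN;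
`PoloidalLiouville` (1222), `UnthreadedRigidity` (27585) OPEN; W1 movement 0; NS regularity NOT proved.  [folklore]
-/

-- the summit and its single sub-problem share the name (CONVENTIONS §1)
set_option linter.dupNamespace false

noncomputable section

open MvPolynomial Complex
open scoped Polynomial RealInnerProductSpace
open Literature.Analysis.FluidPDE (cross)

namespace Summit.NavierStokesRegularity.NavierStokesRegularity.Theorems.PoloidalLiouville.HorizonTower

section FiniteTower

variable (K : Finset ℕ) (H : ℕ → E3 → ℝ)

/-- ★★ **THM H, polynomial level.**  In a finite tower passing order one with top pair `D′ = 2(m+2) < D = 2(n+2)`, `m+2 ⊥ n+2`,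
`P_D, P_{D′} ≠ 0` and no shell of degree `D′ − 2`, the top shell is annihilated by the rotation derivative about a real axis. [folklore] -/
theorem finiteTower_exists_axis_of_evenPair (hK : ∀ l ∈ K, 1 ≤ l) (hH : ∀ l ∈ K, ContDiff ℝ (⊤ : ℕ∞) (H l))
    (hhom : ∀ l ∈ K, ∀ (c : ℝ) (y : E3), H l (c • y) = c ^ l * H l y)
    (hharm : ∀ l ∈ K, ∀ y, Laplacian.laplacian (H l) y = 0)
    (hL1 : ∀ x : E3, x ≠ 0 → horizonL1 (fun z => ∑ l ∈ K, horizonProfile l (H l) 0 z) 0 x = 0)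
    (P : ℕ → MvPolynomial (Fin 3) ℝ)
    (hP : ∀ l ∈ K, (P l).IsHomogeneous l ∧ Zonal.lapP (P l) = 0 ∧ ∀ y, H l y = Zonal.evalE (P l) y)
    {m n : ℕ} (hmn : m < n) (hcop : (m + 2).Coprime (n + 2)) (hD : 2 * (n + 2) ∈ K) (hD' : 2 * (m + 2) ∈ K)
    (hmax : ∀ l ∈ K, l ≤ 2 * (n + 2)) (hsec : ∀ l ∈ K, l ≠ 2 * (n + 2) → l ≤ 2 * (m + 2))
    (hgap : ∀ l ∈ K, l + 2 ≠ 2 * (m + 2)) (hPD : P (2 * (n + 2)) ≠ 0) (hPD' : P (2 * (m + 2)) ≠ 0) :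
    ∃ v : Fin 3 → ℝ, v ≠ 0 ∧ Zonal.detP (C (v 0) * X 0 + C (v 1) * X 1 + C (v 2) * X 2) (P (2 * (n + 2))) = 0 := by
  classical
  set D : ℕ := 2 * (n + 2) with hDdef
  set D' : ℕ := 2 * (m + 2) with hD'def
  have hlt : D' < D := by omega
  have hρ0 : (Zonal.normSq : Zonal.RPoly) ≠ 0 := Zonal.rho_ne_zero
  obtain ⟨hPDh, hPDl, hPDe⟩ := hP D hD
  obtain ⟨hPD'h, hPD'l, hPD'e⟩ := hP D' hD'
  -- (0) the class identity modulo `ρ²`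
  obtain ⟨R, hR⟩ := finiteTower_topPair_mod_normSq_sq K H hK hH hhom hharm hL1 P (fun l hl => (hP l hl).2.2) hD hD'
    (by omega) hmax hsec hgap
  -- (1) the null-cone digit: weighted Wronskian law of the top pair
  set f : ℂ[X] := Zonal.chartT (map (algebraMap ℝ ℂ) (P D')) with hf
  set g : ℂ[X] := Zonal.chartT (map (algebraMap ℝ ℂ) (P D)) with hg
  have hW := finiteTower_top_wronskian K H hK hH hhom hharm hL1 P (fun l hl => ⟨(hP l hl).1, (hP l hl).2.2⟩) hD hD' hlt
    hmax hsec
  rw [← hf, ← hg] at hW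
  have hW' : ((m + 2 : ℕ) : ℂ[X]) * f * Polynomial.derivative g = ((n + 2 : ℕ) : ℂ[X]) * g * Polynomial.derivative f := by
    have h2 : (2 : ℂ[X]) * (((m + 2 : ℕ) : ℂ[X]) * f * Polynomial.derivative g - ((n + 2 : ℕ) : ℂ[X]) * g * Polynomial.derivative f)
        = 0 := by
      rw [hDdef, hD'def] at hW; push_cast at hW ⊢; linear_combination hW
    exact sub_eq_zero.mp ((mul_eq_zero.mp h2).resolve_left two_ne_zero)
  have hWr := Zonal.wronskian_pow_pow_eq_zero (a := m + 2) (b := n + 2) (by omega) (by omega) hW'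
  have hg0 : g ≠ 0 := fun h => hPD (Zonal.eq_zero_of_chartT_map_eq_zero hPDh hPDl h)
  have hf0 : f ≠ 0 := fun h => hPD' (Zonal.eq_zero_of_chartT_map_eq_zero hPD'h hPD'l h)
  obtain ⟨c, hc⟩ := Zonal.exists_C_mul_of_wronskian_eq_zero (pow_ne_zero _ hg0) hWr
  set lc : ℂ := g.leadingCoeff with hlc
  obtain ⟨q, hqm, hgq, hdeg⟩ := Zonal.exists_monic_eq_C_mul_pow_of_coprime (a := n + 2) (b := m + 2) hcop.symm (by omega) hf0 hc
  rw [← hlc] at hgq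
  have hq0 : q ≠ 0 := hqm.ne_zero
  have hq4 : q.natDegree ≤ 4 := by
    have h1 : g.natDegree ≤ 2 * D := Zonal.natDegree_chartT_le (hPDh.map (algebraMap ℝ ℂ))
    have h2 : (n + 2) * q.natDegree ≤ (n + 2) * 4 := by rw [hdeg]; rw [hDdef] at h1; linarith
    exact Nat.le_of_mul_le_mul_left h2 (by omega)
  have hfp : f ^ (n + 2) = Polynomial.C (c * lc ^ (m + 2)) * (q ^ (m + 2)) ^ (n + 2) := by
    rw [hc, hgq, mul_pow, ← Polynomial.C_pow, ← mul_assoc, ← Polynomial.C_mul, ← pow_mul, ← pow_mul, mul_comm (n + 2)]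
  obtain ⟨γ, hγ⟩ := Zonal.exists_eq_C_mul_pow_of_pow_eq (D := n + 2) (d := m + 2) (by omega) hq0 hfp
  -- (2) the quadratic generator and its reality
  obtain ⟨qa, qb, qd, qe, qf, hgen⟩ := Zonal.exists_gen_chartT_eq hq4
  rw [← hgen] at hγ hgq
  obtain ⟨w, ra, rb, rd, re, rf, hwa, hwb, hwd, hwe, hwf⟩ :=
    Zonal.exists_real_gen_of_chartT_map_eq_pow hPDh hPDl hPD (by omega : 1 ≤ n + 2) hDdef hgq
  rw [hwa, hwb, hwd, hwe, hwf] at hγ hgq hgen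
  set L := Zonal.genL ra rb rd re rf with hLdef
  have hmapL : map (algebraMap ℝ ℂ) L = Zonal.genL (ra : ℂ) rb rd re rf := by rw [hLdef, Zonal.map_genL]; rfl
  have hchartw : Zonal.chartT (Zonal.genL (w * ra) (w * rb) (w * rd) (w * re) (w * rf))
      = Polynomial.C w * Zonal.chartT (map (algebraMap ℝ ℂ) L) := by
    rw [Zonal.genL_smul, Zonal.chartT_mul, Zonal.chartT_C, hmapL]
  rw [hchartw, mul_pow, ← Polynomial.C_pow, ← mul_assoc, ← Polynomial.C_mul] at hγ hgq
  have hL0 : L ≠ 0 := by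
    intro h0; apply hq0
    rw [← hgen, hchartw, h0, map_zero, Zonal.chartT_zero, mul_zero]
  -- (3) real coefficients and remainders
  obtain ⟨g₂, G₂, hG₂, hPDeq⟩ := Zonal.exists_coeff_remainder_of_chartT_map_eq_pow hPDh hDdef hL0 hgq
  obtain ⟨g₁, G₁, hG₁, hPD'eq⟩ := Zonal.exists_coeff_remainder_of_chartT_map_eq_pow hPD'h hD'def hL0 hγ
  have hG₂' : G₂.IsHomogeneous (2 * n + 2) := by rw [show 2 * n + 2 = 2 * (n + 2) - 2 by omega]; exact hG₂
  have hG₁' : G₁.IsHomogeneous (2 * m + 2) := by rw [show 2 * m + 2 = 2 * (m + 2) - 2 by omega]; exact hG₁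
  have hLc : Zonal.chartT (map (algebraMap ℝ ℂ) L) ≠ 0 := fun h0 =>
    hL0 (Zonal.eq_zero_of_chartT_map_eq_zero (Zonal.isHomogeneous_genL ra rb rd re rf) (Zonal.lapP_genL ra rb rd re rf) h0)
  have hchartPD : Zonal.chartT (map (algebraMap ℝ ℂ) (P D))
      = Polynomial.C ((g₂ : ℝ) : ℂ) * Zonal.chartT (map (algebraMap ℝ ℂ) L) ^ (n + 2) := by
    rw [hPDeq, map_add, map_mul, map_C, map_pow, map_mul, Zonal.map_normSq, Zonal.chartT_add, Zonal.chartT_mul, Zonal.chartT_C,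
      Zonal.chartT_pow, Zonal.chartT_mul, Zonal.chartT_normSq, zero_mul, add_zero]
    rfl
  have hg₂0 : g₂ ≠ 0 := by
    rintro rfl
    apply hg0
    rw [hg, hchartPD]; simp
  have hg₁0 : g₁ ≠ 0 := by
    rintro rfl
    apply hf0
    rw [hf, hPD'eq, map_add, map_mul, map_C, map_pow, map_mul, Zonal.map_normSq, Zonal.chartT_add, Zonal.chartT_mul,
      Zonal.chartT_C, Zonal.chartT_pow, Zonal.chartT_mul, Zonal.chartT_normSq, zero_mul, add_zero]
    simp
  -- (4) the second digit
  have h2 := Zonal.secondDigit_detP ra rb rd re rf hG₁' hG₂' hPD'eq hPDeq hPD'l hPDl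
  set c₀ : ℝ := 2 * ((D' : ℝ) * (D' + 1) - (D : ℝ) * (D + 1)) with hc₀
  set c₉ : ℝ := 96 * ((m : ℝ) + 2) * ((n : ℝ) + 2) * ((m : ℝ) - n) * g₁ * g₂ with hc₉
  set k₁₂ : ℝ := (8 * (m : ℝ) + 14) * (8 * (n : ℝ) + 14) with hk₁₂
  obtain ⟨B', h2'⟩ : ∃ B' : Zonal.RPoly, C k₁₂ * Zonal.detP (P D') (P D)
      = Zonal.normSq * (C c₉ * L ^ (m + n + 1) * Zonal.genW ra rb rd re rf + Zonal.normSq * B') := ⟨_, h2⟩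
  -- combine with the class identity and cancel one `ρ`
  have hcomb : Zonal.normSq * (C c₀ * C c₉ * (L ^ (m + n + 1) * Zonal.genW ra rb rd re rf)
      + Zonal.normSq * (C c₀ * B' + C k₁₂ * R)) = 0 := by
    linear_combination (C k₁₂) * hR - (C c₀) * h2'
  have hT := (mul_eq_zero.mp hcomb).resolve_left hρ0
  -- (5) the chart: `chartT W = 0`, hence `W = 0`
  have hc₀0 : c₀ ≠ 0 := by
    rw [hc₀]; exact mul_ne_zero two_ne_zero (mul_succ_ne_of_ne (l := D') (m := D) hlt.ne)
  have hc₉0 : c₉ ≠ 0 := by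
    rw [hc₉]
    have hmn' : ((m : ℝ) - n) ≠ 0 := sub_ne_zero.mpr (by exact_mod_cast hmn.ne)
    have hm2 : ((m : ℝ) + 2) ≠ 0 := by positivity
    have hn2 : ((n : ℝ) + 2) ≠ 0 := by positivity
    exact mul_ne_zero (mul_ne_zero (mul_ne_zero (mul_ne_zero (mul_ne_zero (by norm_num) hm2) hn2) hmn') hg₁0) hg₂0
  have hWchart : Zonal.chartT (map (algebraMap ℝ ℂ) (Zonal.genW ra rb rd re rf)) = 0 := by
    have h1 : Polynomial.C ((algebraMap ℝ ℂ) c₀) * Polynomial.C ((algebraMap ℝ ℂ) c₉)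
        * (Zonal.chartT (map (algebraMap ℝ ℂ) L) ^ (m + n + 1) * Zonal.chartT (map (algebraMap ℝ ℂ) (Zonal.genW ra rb rd re rf)))
        = 0 := by
      have h := congrArg (fun p : Zonal.RPoly => Zonal.chartT (map (algebraMap ℝ ℂ) p)) hT
      simp only [map_add, map_mul, map_pow, Zonal.map_normSq, Zonal.chartT_add, Zonal.chartT_mul, Zonal.chartT_pow,
        Zonal.chartT_normSq, zero_mul, add_zero, map_zero, Zonal.chartT_zero, map_C, Zonal.chartT_C] at h
      linear_combination h
    have hA : (Polynomial.C ((algebraMap ℝ ℂ) c₀) : ℂ[X]) ≠ 0 := by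
      rw [Ne, Polynomial.C_eq_zero, map_eq_zero_iff _ (RCLike.ofReal_injective)]; exact hc₀0
    have hB : (Polynomial.C ((algebraMap ℝ ℂ) c₉) : ℂ[X]) ≠ 0 := by
      rw [Ne, Polynomial.C_eq_zero, map_eq_zero_iff _ (RCLike.ofReal_injective)]; exact hc₉0
    exact (mul_eq_zero.mp ((mul_eq_zero.mp h1).resolve_left (mul_ne_zero hA hB))).resolve_left (pow_ne_zero _ hLc)
  have hW0 : Zonal.genW ra rb rd re rf = 0 :=
    Zonal.eq_zero_of_chartT_map_eq_zero (Zonal.isHomogeneous_genW ra rb rd re rf) (Zonal.lapP_genW ra rb rd re rf) hWchart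
  -- (6) `{L, M₀} = 0`, same-degree rigidity, the uniaxial lemma
  set M₀ : Zonal.RPoly := Zonal.genM ra rb rd re rf - C (Zonal.genTau ra rb rd re rf / 3) * Zonal.normSq with hM₀
  have hM₀h : M₀.IsHomogeneous 2 := (Zonal.isHomogeneous_genM ra rb rd re rf).sub (Zonal.isHomogeneous_normSq.C_mul _)
  have hM₀l : Zonal.lapP M₀ = 0 := by
    rw [hM₀, Zonal.lapP_sub, Zonal.lapP_C_mul, Zonal.lapP_genM, Zonal.lapP_normSq, ← map_mul, ← map_sub,
      show 2 * Zonal.genTau ra rb rd re rf - Zonal.genTau ra rb rd re rf / 3 * 6 = 0 by ring, map_zero]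
  have hbr : Zonal.detP L M₀ = 0 := by
    rw [hM₀, Zonal.detP_sub_right, Zonal.detP_C_mul_right, Zonal.detP_normSq_right, mul_zero, sub_zero, hLdef,
      Zonal.detP_genL_genM, hW0, mul_zero]
  obtain ⟨β, hβ⟩ := LoopLaw.sameDegreeBracketRigidity 2 L M₀ (by norm_num)
    ⟨Zonal.isHomogeneous_genL ra rb rd re rf, Zonal.laplacian_eval_eq_zero_of_lapP (Zonal.lapP_genL ra rb rd re rf)⟩
    ⟨hM₀h, Zonal.laplacian_eval_eq_zero_of_lapP hM₀l⟩ hL0 (Zonal.bracket_eval_eq_zero_of_detP hbr)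
  have hM : Zonal.genM ra rb rd re rf = C β * Zonal.genL ra rb rd re rf + C (Zonal.genTau ra rb rd re rf / 3) * Zonal.normSq := by
    rw [← hLdef, ← smul_eq_C_mul, ← hβ, hM₀]; ring
  obtain ⟨v, hv, hrot⟩ := Zonal.exists_axis_of_genM_eq ra rb rd re rf hM
  refine ⟨v, hv, ?_⟩
  -- (7) zonality of the top shell from the zonality of the generator
  set a : Fin 3 → ℂ := fun i => ((v i : ℝ) : ℂ) with ha'
  have ha : a ≠ 0 := ofReal_axis_ne_zero hv
  have hlin : map (algebraMap ℝ ℂ) (C (v 0) * X 0 + C (v 1) * X 1 + C (v 2) * X 2 : MvPolynomial (Fin 3) ℝ)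
      = C (a 0) * X 0 + C (a 1) * X 1 + C (a 2) * X 2 := map_lin v
  have hrotL : Zonal.detP (C (a 0) * X 0 + C (a 1) * X 1 + C (a 2) * X 2) (map (algebraMap ℝ ℂ) L) = 0 := by
    rw [← hlin, ← Zonal.map_detP, hrot, map_zero]
  obtain ⟨β', hβ'⟩ := Zonal.exists_chartT_eq_C_mul_pow_of_detP_lin_eq_zero ((Zonal.isHomogeneous_genL ra rb rd re rf).map _)
    (by norm_num) ha hrotL
  have hchartD : Zonal.chartT (map (algebraMap ℝ ℂ) (P D))
      = Polynomial.C (((g₂ : ℝ) : ℂ) * β' ^ (n + 2)) * Zonal.chartT (C (a 0) * X 0 + C (a 1) * X 1 + C (a 2) * X 2) ^ D := by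
    rw [hchartPD, hβ', mul_pow, ← Polynomial.C_pow, ← mul_assoc, ← Polynomial.C_mul, ← pow_mul, hDdef]
  have hzon := Zonal.detP_lin_eq_zero_of_chartT_eq (hPDh.map (algebraMap ℝ ℂ)) (hK D hD)
    (by rw [← Zonal.map_lapP, hPDl, map_zero]) a hchartD
  rw [← hlin, ← Zonal.map_detP, map_eq_zero_iff _ (map_injective (algebraMap ℝ ℂ) (RCLike.ofReal_injective))] at hzon
  exact hzon

/-- ★★ **THM H — THE SECOND CONE DIGIT.**  A scale-free finite tower of horizon profiles of smooth homogeneous harmonic shells (degrees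
`≥ 1`) annihilated by the order-one horizon law off the centre, whose two largest degrees are `D′ = 2(m+2) < D = 2(n+2)` with
`m + 2`, `n + 2` coprime, with `H_D, H_{D′} ≢ 0` and no shell of degree `D′ − 2`, is COAXIALLY ZONAL: one axis `a ≠ 0` has
`⟪a × y, ∇H_l⟫ ≡ 0` for every shell. [folklore] -/
theorem finiteTower_zonal_of_evenPair (hK : ∀ l ∈ K, 1 ≤ l) (hH : ∀ l ∈ K, ContDiff ℝ (⊤ : ℕ∞) (H l))
    (hhom : ∀ l ∈ K, ∀ (c : ℝ) (y : E3), H l (c • y) = c ^ l * H l y)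
    (hharm : ∀ l ∈ K, ∀ y, Laplacian.laplacian (H l) y = 0)
    (hL1 : ∀ x : E3, x ≠ 0 → horizonL1 (fun z => ∑ l ∈ K, horizonProfile l (H l) 0 z) 0 x = 0)
    {m n : ℕ} (hmn : m < n) (hcop : (m + 2).Coprime (n + 2)) (hD : 2 * (n + 2) ∈ K) (hD' : 2 * (m + 2) ∈ K)
    (hmax : ∀ l ∈ K, l ≤ 2 * (n + 2)) (hsec : ∀ l ∈ K, l ≠ 2 * (n + 2) → l ≤ 2 * (m + 2))
    (hgap : ∀ l ∈ K, l + 2 ≠ 2 * (m + 2)) (hD0 : ∃ y, H (2 * (n + 2)) y ≠ 0) (hD'0 : ∃ y, H (2 * (m + 2)) y ≠ 0) :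
    ∃ a : E3, a ≠ 0 ∧ ∀ l ∈ K, ∀ y : E3, ⟪cross a y, gradient (H l) y⟫ = 0 := by
  obtain ⟨P, hP⟩ := finiteTower_exists_polys K H hH hhom hharm
  have hne : ∀ {l}, l ∈ K → (∃ y, H l y ≠ 0) → P l ≠ 0 := by
    intro l hl ⟨y, hy⟩ h
    apply hy
    rw [(hP l hl).2.2 y, h]
    simp [Zonal.evalE]
  obtain ⟨v, hv, htop⟩ := finiteTower_exists_axis_of_evenPair K H hK hH hhom hharm hL1 P hP hmn hcop hD hD' hmax hsec hgap
    (hne hD hD0) (hne hD' hD'0)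
  have hna : (WithLp.toLp 2 v : E3) ≠ 0 := by
    intro h
    apply hv
    funext i
    have := congrArg (fun u : E3 => u i) h
    simpa using this
  refine ⟨WithLp.toLp 2 v, hna, fun l hl y => ?_⟩
  have h := finiteTower_detP_lin_eq_zero_of_top K H hK hH hhom hharm hL1 P hP hD hmax (hne hD hD0) hv htop l hl
  rw [Zonal.detP_lin_eq_zero_iff] at h
  have := h y
  rwa [← show H l = Zonal.evalE (P l) from funext (hP l hl).2.2] at this

/-- THM H with the ZONAL FUNCTIONAL FORMS of the Defs twin as conclusion. [folklore] -/
theorem finiteTower_zonalForm_of_evenPair (hK : ∀ l ∈ K, 1 ≤ l) (hH : ∀ l ∈ K, ContDiff ℝ (⊤ : ℕ∞) (H l))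
    (hhom : ∀ l ∈ K, ∀ (c : ℝ) (y : E3), H l (c • y) = c ^ l * H l y)
    (hharm : ∀ l ∈ K, ∀ y, Laplacian.laplacian (H l) y = 0)
    (hL1 : ∀ x : E3, x ≠ 0 → horizonL1 (fun z => ∑ l ∈ K, horizonProfile l (H l) 0 z) 0 x = 0)
    {m n : ℕ} (hmn : m < n) (hcop : (m + 2).Coprime (n + 2)) (hD : 2 * (n + 2) ∈ K) (hD' : 2 * (m + 2) ∈ K)
    (hmax : ∀ l ∈ K, l ≤ 2 * (n + 2)) (hsec : ∀ l ∈ K, l ≠ 2 * (n + 2) → l ≤ 2 * (m + 2))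
    (hgap : ∀ l ∈ K, l + 2 ≠ 2 * (m + 2)) (hD0 : ∃ y, H (2 * (n + 2)) y ≠ 0) (hD'0 : ∃ y, H (2 * (m + 2)) y ≠ 0) :
    ∃ a : E3, a ≠ 0 ∧ ∀ l ∈ K, ∃ g : ℝ → ℝ, ∀ y : E3, y ≠ 0 → H l y = ‖y‖ ^ l * g (⟪a, y⟫ / ‖y‖) := by
  obtain ⟨a, ha, hall⟩ := finiteTower_zonal_of_evenPair K H hK hH hhom hharm hL1 hmn hcop hD hD' hmax hsec hgap hD0 hD'0
  refine ⟨a, ha, fun l hl => ?_⟩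
  exact exists_zonalForm_of_inner_cross_gradient_eq_zero (l := l) ha ((hH l hl).differentiable (by simp))
    (fun c y _ => hhom l hl c y) (hall l hl)

end FiniteTower

end Summit.NavierStokesRegularity.NavierStokesRegularity.Theorems.PoloidalLiouville.HorizonTower

end
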